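import Summits.CriticalPhenomena.PercolationContinuityZ3.Theorems.FK.NewmanCLTDominated
import Summits.CriticalPhenomena.PercolationContinuityZ3.Theorems.FK.LocalPatternCLT
import HarnessLib

/-!
# CENTRAL LIMIT THEOREM FOR ARBITRARY (NON-MONOTONE) LOCAL OBSERVABLES OF THE RANDOM-CLUSTER MEASURE `φ^b_{p,q}`
# BELOW `p_c(q)` (`d ≥ 2`, `q ≥ 1`): `(Σ_{z∈Λ_n} f(ω − z) − E)/√|Λ_n| ⇒ N(0, σ²_f)` for `f = Σ_a c_a 1_{E_a}`, `E_a` local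

Claimed R42 (8)(c) in the cell INBOX at 2026-08-28T14:25:01Z by fkp-10a gen 354 (NEW CLAIM #3 of the gen), addressed to coordinator fk-4 g274 (seated 13:10Z 2026-08-28 by l.8389; R151 l.8390, R152 l.8413); lineage row FO-10a-g354g (self-suggested), package g354-cltgeneral, label GD-D.
Helper file of the `fk-continuity` build cell (bschramm lane; `--supports stmt-CriticalPhenomena-4575`); builds on
p205010 (kernel theorem, internal audit signed; external expert review pending). No definitions, no named facts, no
sorries; standard axioms. UNCONDITIONAL.

A LOCAL OBSERVABLE is a finite real combination `f = Σ_{a∈A} c_a 1_{E_a}` of events `E_a` determined by a finite edge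
set `F ⊆ E(Λ_k)` (every function of the edges of `F` is of this form via the `2^{|F|}` cylinder events; no sign or
monotonicity restriction). Such an `f` is DOMINATED by the increasing local observable `(Σ_a |c_a|)·N_F`,
`N_F(ω) = #{e ∈ F : e open}` (`abs_indicator_sub_le_openCount_sub`: raising edges of `F` changes `1_E` by at most the
number of edges raised), so Newman's CLT for dominated fields (`tendstoInDistribution_boxSum_of_dominated`) applies to
`X_z = f ∘ T_z` (`T_z ω = ω − z`) once both covariance kernels are summable — which below `p_c(q)` follows from the
translation mixing of LOCAL (not necessarily monotone) events (tree: `exists_exp_translate_mixing_of_lt_rcCriticalProb`,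
Alexander (1.1) via DRT sharpness):

* `covariance_comp_shift_eq` — (B) for arbitrary measurable `g, h`: `Cov(g∘T_x, h∘T_y) = Cov(g, h∘T_{y−x})`;
* `exists_abs_cov_indicator_shift_le` — `|Cov(1_E, 1_{E'}∘T_z)| ≤ 4(|F|+1)e^{c(2k+1)}e^{−c‖z‖_∞}`, `E, E'` determined by `F`;
* `abs_cov_combination_shift_le` — bilinearity: `|Cov(f, f'∘T_z)| ≤ (Σ|c_a|)(Σ|c'_b|)·B` when every pair is bounded by `B`;
* `tendstoInDistribution_localObservable` — **the CLT** for `0 ≤ p < p_c(q)`, both `b`: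
  `(Σ_{z∈Λ_n} f(ω − z) − E_{φ^b}[…])/√|Λ_n| → N(0, σ²_f)`, `σ²_f = Σ_z Cov_{φ^b}(f, f ∘ T_z)` (`≥ 0`, as an `ℝ≥0`).

## References

* C. M. Newman, *Normal fluctuations and the FKG inequalities*, Comm. Math. Phys. 74 (1980) 119–128, Thm. 2 and the
  remark after (12); *A general central limit theorem for FKG systems*, Comm. Math. Phys. 91 (1983) 75–80. [Newman1980]
* G. Grimmett, *The Random-Cluster Model*, Springer 2006, Thm. (4.17)(b), Thm. (4.19)(b), Cor. (4.23). [Grimmett2006]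
* K. S. Alexander, *On weak mixing in lattice models*, PTRF 110 (1998) 441–471, (1.1). [Alexander1998]
-/

noncomputable section

namespace Summit.CriticalPhenomena.PercolationContinuityZ3.Theorems.FK

namespace NewmanCLT

open MeasureTheory ProbabilityTheory Complex Finset Filter Topology
open Literature.Probability.Percolation Literature.Probability.LatticeModels Literature.Barriers.CriticalPhenomena
open BoundaryInfluence

variable {d : ℕ} {p q : ℝ}

/-! ### Domination of local events by the open-edge count of `F` -/

/-- One-edge indicators are increasing (any pair `e`). [cite: Grimmett2006, §2.1] -/
theorem monotone_indicator_setOf_mem (e : Sym2 (Site d)) :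
    Monotone fun ω : BondConfig (Site d) => ({ω' : BondConfig (Site d) | e ∈ ω'}).indicator (1 : BondConfig (Site d) → ℝ) ω := by
  intro η η' hle
  dsimp only
  by_cases h : e ∈ η
  · have h' : e ∈ η' := hle h
    rw [Set.indicator_of_mem (show η ∈ {ω : BondConfig (Site d) | e ∈ ω} from h),
      Set.indicator_of_mem (show η' ∈ {ω : BondConfig (Site d) | e ∈ ω} from h'), Pi.one_apply, Pi.one_apply]
  · rw [Set.indicator_of_notMem (show η ∉ {ω : BondConfig (Site d) | e ∈ ω} from h)]
    exact Set.indicator_nonneg (fun _ _ => zero_le_one) _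

/-- **An event determined by `F` is dominated by the open-edge count of `F`**: for `η ≤ η'`,
`|1_E(η') − 1_E(η)| ≤ N_F(η') − N_F(η)`, `N_F(η) = Σ_{e∈F} 1{e ∈ η}`. [cite: Newman1980, remark after (12)] -/
theorem abs_indicator_sub_le_openCount_sub {F : Finset (Sym2 (Site d))} {E : Set (BondConfig (Site d))}
    (hE : DeterminedBy E ↑F) {η η' : BondConfig (Site d)} (hle : η ≤ η') :
    |E.indicator (1 : BondConfig (Site d) → ℝ) η' - E.indicator (1 : BondConfig (Site d) → ℝ) η| ≤
      ∑ e ∈ F, ({ω : BondConfig (Site d) | e ∈ ω}).indicator (1 : BondConfig (Site d) → ℝ) η' -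
        ∑ e ∈ F, ({ω : BondConfig (Site d) | e ∈ ω}).indicator (1 : BondConfig (Site d) → ℝ) η := by
  rw [← Finset.sum_sub_distrib]
  have hterm : ∀ e ∈ F, 0 ≤ ({ω : BondConfig (Site d) | e ∈ ω}).indicator (1 : BondConfig (Site d) → ℝ) η' -
      ({ω : BondConfig (Site d) | e ∈ ω}).indicator (1 : BondConfig (Site d) → ℝ) η :=
    fun e _ => sub_nonneg.2 (monotone_indicator_setOf_mem e hle)
  by_cases hex : ∃ e ∈ F, e ∈ η' ∧ e ∉ η
  swap
  · -- `η`, `η'` agree on `F`: the event cannot tell them apart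
    have hflat : ∀ e ∈ F, (e ∈ η' ↔ e ∈ η) := fun e he =>
      ⟨fun h1 => by_contra fun h2 => hex ⟨e, he, h1, h2⟩, fun h => hle h⟩
    have hagree : η' ∩ ↑F = η ∩ ↑F := by
      ext e
      simp only [Set.mem_inter_iff, Finset.mem_coe]
      constructor
      · rintro ⟨h1, h2⟩; exact ⟨(hflat e h2).1 h1, h2⟩
      · rintro ⟨h1, h2⟩; exact ⟨(hflat e h2).2 h1, h2⟩
    have hiff := (determinedBy_iff E ↑F).1 hE η' η hagree
    have h0 : E.indicator (1 : BondConfig (Site d) → ℝ) η' = E.indicator (1 : BondConfig (Site d) → ℝ) η := by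
      by_cases hη : η ∈ E
      · rw [Set.indicator_of_mem hη, Set.indicator_of_mem (hiff.2 hη), Pi.one_apply, Pi.one_apply]
      · rw [Set.indicator_of_notMem hη, Set.indicator_of_notMem (fun h => hη (hiff.1 h))]
    rw [h0, sub_self, abs_zero]
    exact Finset.sum_nonneg hterm
  · obtain ⟨e, heF, he'⟩ := hex
    have hone : ({ω : BondConfig (Site d) | e ∈ ω}).indicator (1 : BondConfig (Site d) → ℝ) η' -
        ({ω : BondConfig (Site d) | e ∈ ω}).indicator (1 : BondConfig (Site d) → ℝ) η = 1 := by
      rw [Set.indicator_of_mem (show η' ∈ {ω : BondConfig (Site d) | e ∈ ω} from he'.1),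
        Set.indicator_of_notMem (show η ∉ {ω : BondConfig (Site d) | e ∈ ω} from he'.2), Pi.one_apply, sub_zero]
    have hge : (1 : ℝ) ≤ ∑ e ∈ F, (({ω : BondConfig (Site d) | e ∈ ω}).indicator (1 : BondConfig (Site d) → ℝ) η' -
        ({ω : BondConfig (Site d) | e ∈ ω}).indicator (1 : BondConfig (Site d) → ℝ) η) := by
      rw [← hone]
      exact Finset.single_le_sum hterm heF
    refine le_trans ?_ hge
    have h1 := abs_indicator_one_le_one E η'
    have h2 := abs_indicator_one_le_one E η
    have hn1 : 0 ≤ E.indicator (1 : BondConfig (Site d) → ℝ) η' := Set.indicator_nonneg (fun _ _ => zero_le_one) _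
    have hn2 : 0 ≤ E.indicator (1 : BondConfig (Site d) → ℝ) η := Set.indicator_nonneg (fun _ _ => zero_le_one) _
    rw [abs_le] at h1 h2 ⊢
    constructor <;> linarith [h1.2, h2.2]

/-! ### (B) Translation covariance for arbitrary observables -/

/-- **(B) for arbitrary observables**: `Cov_{φ^b}(g ∘ T_x, h ∘ T_y) = Cov_{φ^b}(g, h ∘ T_{y−x})` for measurable `g, h`.
[cite: Grimmett2006, Thm. (4.19)(b)] -/
theorem covariance_comp_shift_eq (b : Bool) (hp : p ∈ Set.Icc (0 : ℝ) 1) (hq : 1 ≤ q) {g h : BondConfig (Site d) → ℝ}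
    (hg : Measurable g) (hh : Measurable h) (x y : Site d) :
    cov[fun ω => g (BondConfig.relabel (sym2Equiv (Site.shift (-x))) ω),
      fun ω => h (BondConfig.relabel (sym2Equiv (Site.shift (-y))) ω); rcLimit d b p q] =
    cov[g, fun ω => h (BondConfig.relabel (sym2Equiv (Site.shift (-(y - x)))) ω); rcLimit d b p q] := by
  have hT := (isBoxLimit_rcLimit b hp hq).measurePreserving_relabel_shift hp hq (-x)
  have hm2 : Measurable fun ω => h (BondConfig.relabel (sym2Equiv (Site.shift (-(y - x)))) ω) :=
    hh.comp (BondConfig.relabel (sym2Equiv (Site.shift (-(y - x))))).measurable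
  conv_rhs => rw [← hT.map_eq]
  rw [covariance_map_fun hg.aestronglyMeasurable hm2.aestronglyMeasurable hT.measurable.aemeasurable]
  simp_rw [relabel_shift_neg_relabel_shift_neg_apply, add_sub_cancel]

/-! ### Covariance decay for pairs of local events below `p_c(q)` -/

/-- **`|Cov_{φ^b}(1_E, 1_{E'} ∘ T_z)| ≤ 4(|F|+1)e^{c(2k+1)}·e^{−c‖z‖_∞}`** for any two events `E, E'` determined by
`F ⊆ E(Λ_k)` and `0 ≤ p < p_c(q)`, uniformly in `E, E'`, `b`, `z`. [cite: Alexander1998, (1.1); Grimmett2006, Cor. (4.23)] -/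
theorem exists_abs_cov_indicator_shift_le (hd : 2 ≤ d) (hq : 1 ≤ q) (hp0 : 0 ≤ p) (hpc : p < rcCriticalProb d q)
    {k : ℕ} {F : Finset (Sym2 (Site d))} (hF : F ⊆ edgesIn (zdGraph d) (box d k)) :
    ∃ c : ℝ, 0 < c ∧ ∀ (b : Bool) ⦃E E' : Set (BondConfig (Site d))⦄, DeterminedBy E ↑F → DeterminedBy E' ↑F →
      ∀ z : Site d,
      |cov[E.indicator (1 : BondConfig (Site d) → ℝ), fun ω => E'.indicator (1 : BondConfig (Site d) → ℝ)
          (BondConfig.relabel (sym2Equiv (Site.shift (-z))) ω); rcLimit d b p q]| ≤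
        4 * (#F + 1) * Real.exp (c * (2 * k + 1)) * Real.exp (-(c * siteRad z)) := by
  obtain ⟨c, hc, h⟩ := exists_exp_translate_mixing_of_lt_rcCriticalProb hd hq hp0 hpc
  refine ⟨c, hc, fun b E E' hE hE' z => ?_⟩
  haveI := isProbabilityMeasure_rcLimit (d := d) b p q
  have hp : p ∈ Set.Icc (0 : ℝ) 1 := ⟨hp0, (hpc.trans (rcCriticalProb_lt_one hd hq)).le⟩
  have hEm : MeasurableSet E := measurableSet_of_isLocalEvent_holds ⟨F, hE⟩
  have hE'm : MeasurableSet E' := measurableSet_of_isLocalEvent_holds ⟨F, hE'⟩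
  set P := rcLimit d b p q with hP
  set A := BondConfig.relabel (sym2Equiv (Site.shift (-z))) ⁻¹' E' with hA
  have hAm : MeasurableSet A := (BondConfig.relabel (sym2Equiv (Site.shift (-z)))).measurable hE'm
  have hind : (fun ω => E'.indicator (1 : BondConfig (Site d) → ℝ) (BondConfig.relabel (sym2Equiv (Site.shift (-z))) ω)) =
      A.indicator (1 : BondConfig (Site d) → ℝ) := by
    funext ω
    by_cases hω : BondConfig.relabel (sym2Equiv (Site.shift (-z))) ω ∈ E'
    · rw [Set.indicator_of_mem hω, Set.indicator_of_mem (Set.mem_preimage.2 hω), Pi.one_apply, Pi.one_apply]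
    · rw [Set.indicator_of_notMem hω, Set.indicator_of_notMem (fun h' => hω (Set.mem_preimage.1 h'))]
  rw [hind, covariance_indicator_one_eq _ hEm hAm]
  have hAE : P.real A = P.real E' := by
    rw [measureReal_def, hA, hP, (isBoxLimit_rcLimit b hp hq).measure_preimage_relabel_shift hp hq (-z) E', measureReal_def]
  rw [hAE]
  have htriv : |P.real (E ∩ A) - P.real E * P.real E'| ≤ 1 := by
    have h1 : P.real (E ∩ A) ≤ 1 := measureReal_le_one
    have h2 : P.real E ≤ 1 := measureReal_le_one
    have h3 : P.real E' ≤ 1 := measureReal_le_one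
    have h4 : 0 ≤ P.real (E ∩ A) := measureReal_nonneg
    have h5 : 0 ≤ P.real E := measureReal_nonneg
    have h6 : 0 ≤ P.real E' := measureReal_nonneg
    rw [abs_le]; constructor <;> nlinarith
  have hC1 : (1 : ℝ) ≤ 4 * (#F + 1) * Real.exp (c * (2 * k + 1)) * Real.exp (-(c * siteRad z)) ↔
      Real.exp (c * siteRad z) ≤ 4 * (#F + 1) * Real.exp (c * (2 * k + 1)) := by
    rw [Real.exp_neg, ← div_eq_mul_inv, le_div_iff₀ (Real.exp_pos _), one_mul]
  by_cases hm : siteRad z ≤ 2 * k + 1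
  · refine htriv.trans (hC1.2 ?_)
    have h1 : Real.exp (c * siteRad z) ≤ Real.exp (c * (2 * k + 1)) :=
      Real.exp_le_exp.2 (mul_le_mul_of_nonneg_left (by exact_mod_cast hm) hc.le)
    have h2 : (1 : ℝ) ≤ 4 * (#F + 1) := by
      have : (0 : ℝ) ≤ #F := Nat.cast_nonneg _
      linarith
    calc Real.exp (c * siteRad z) ≤ 1 * Real.exp (c * (2 * k + 1)) := by rw [one_mul]; exact h1
      _ ≤ 4 * (#F + 1) * Real.exp (c * (2 * k + 1)) := mul_le_mul_of_nonneg_right h2 (Real.exp_pos _).le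
  · rw [not_le] at hm
    have key := h b hF hF hE hE' (v := -z) (by rw [siteRad_neg]; exact_mod_cast hm)
    rw [siteRad_neg] at key
    refine key.trans ?_
    have e : Real.exp (-(c * ((siteRad z : ℝ) - 2 * k - 1))) = Real.exp (c * (2 * k + 1)) * Real.exp (-(c * siteRad z)) := by
      rw [← Real.exp_add]; congr 1; ring
    rw [e]
    have : (4 : ℝ) * #F ≤ 4 * (#F + 1) := by linarith
    have hpos : 0 ≤ Real.exp (c * (2 * k + 1)) * Real.exp (-(c * siteRad z)) := by positivity
    calc 4 * (#F : ℝ) * (Real.exp (c * (2 * k + 1)) * Real.exp (-(c * siteRad z)))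
        ≤ 4 * (#F + 1) * (Real.exp (c * (2 * k + 1)) * Real.exp (-(c * siteRad z))) :=
          mul_le_mul_of_nonneg_right this hpos
      _ = _ := by ring

/-- **Bilinearity**: if every pair covariance `|Cov(1_{E_a}, 1_{E'_{a'}}∘T_z)|` is at most `B`, then for
`f = Σ_{a∈A} c_a 1_{E_a}`, `f' = Σ_{a'∈A'} c'_{a'} 1_{E'_{a'}}`: `|Cov(f, f'∘T_z)| ≤ (Σ_a|c_a|)(Σ_{a'}|c'_{a'}|)·B`. [folklore] -/
theorem abs_cov_combination_shift_le {ι ι' : Type*} (P : Measure (BondConfig (Site d))) [IsProbabilityMeasure P]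
    (A : Finset ι) (A' : Finset ι') (c : ι → ℝ) (c' : ι' → ℝ) {E : ι → Set (BondConfig (Site d))}
    {E' : ι' → Set (BondConfig (Site d))} (hE : ∀ a ∈ A, MeasurableSet (E a)) (hE' : ∀ a ∈ A', MeasurableSet (E' a))
    (z : Site d) {B : ℝ}
    (hB : ∀ a ∈ A, ∀ a' ∈ A', |cov[(E a).indicator (1 : BondConfig (Site d) → ℝ), fun ω => (E' a').indicator
      (1 : BondConfig (Site d) → ℝ) (BondConfig.relabel (sym2Equiv (Site.shift (-z))) ω); P]| ≤ B) :
    |cov[fun ω => ∑ a ∈ A, c a * (E a).indicator (1 : BondConfig (Site d) → ℝ) ω,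
      fun ω => ∑ a' ∈ A', c' a' * (E' a').indicator (1 : BondConfig (Site d) → ℝ)
        (BondConfig.relabel (sym2Equiv (Site.shift (-z))) ω); P]| ≤ (∑ a ∈ A, |c a|) * (∑ a' ∈ A', |c' a'|) * B := by
  have hm : ∀ a ∈ A, MemLp (fun ω => c a * (E a).indicator (1 : BondConfig (Site d) → ℝ) ω) 2 P := fun a ha =>
    (memLp_of_abs_le (measurable_const.indicator (hE a ha)) (fun ω => abs_indicator_one_le_one _ ω) 2).const_mul _
  have hm' : ∀ a' ∈ A', MemLp (fun ω => c' a' * (E' a').indicator (1 : BondConfig (Site d) → ℝ)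
      (BondConfig.relabel (sym2Equiv (Site.shift (-z))) ω)) 2 P := fun a' ha' =>
    (memLp_of_abs_le (measurable_patternAt (hE' a' ha') z) (fun ω => abs_indicator_one_le_one _ _) 2).const_mul _
  rw [covariance_fun_sum_fun_sum' hm hm']
  refine (Finset.abs_sum_le_sum_abs _ _).trans ?_
  refine (Finset.sum_le_sum fun a _ => Finset.abs_sum_le_sum_abs _ _).trans ?_
  have hterm : ∀ a ∈ A, ∀ a' ∈ A', |cov[fun ω => c a * (E a).indicator (1 : BondConfig (Site d) → ℝ) ω,
      fun ω => c' a' * (E' a').indicator (1 : BondConfig (Site d) → ℝ)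
        (BondConfig.relabel (sym2Equiv (Site.shift (-z))) ω); P]| ≤ |c a| * |c' a'| * B := by
    intro a ha a' ha'
    rw [covariance_const_mul_left, covariance_const_mul_right, abs_mul, abs_mul, ← mul_assoc]
    exact mul_le_mul_of_nonneg_left (hB a ha a' ha') (mul_nonneg (abs_nonneg _) (abs_nonneg _))
  calc ∑ a ∈ A, ∑ a' ∈ A', |cov[fun ω => c a * (E a).indicator (1 : BondConfig (Site d) → ℝ) ω,
        fun ω => c' a' * (E' a').indicator (1 : BondConfig (Site d) → ℝ)
          (BondConfig.relabel (sym2Equiv (Site.shift (-z))) ω); P]|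
      ≤ ∑ a ∈ A, ∑ a' ∈ A', |c a| * |c' a'| * B := Finset.sum_le_sum fun a ha => Finset.sum_le_sum fun a' ha' => hterm a ha a' ha'
    _ = (∑ a ∈ A, |c a|) * (∑ a' ∈ A', |c' a'|) * B := by
        simp_rw [Finset.sum_mul_sum, Finset.sum_mul]

/-! ### The central limit theorem for local observables -/

/-- **CENTRAL LIMIT THEOREM FOR LOCAL OBSERVABLES OF `φ^b_{p,q}` BELOW `p_c(q)`**: for `d ≥ 2`, `q ≥ 1`,
`0 ≤ p < p_c(q)`, both `b`, a finite edge set `F ⊆ E(Λ_k)`, finitely many events `E_a` (`a ∈ A`) determined by `F`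
and real coefficients `c_a` — so `f = Σ_a c_a 1_{E_a}` is an ARBITRARY function of the edges of `F` when the `E_a` run
over cylinder events — the sums `S_n = Σ_{z∈Λ_n} f(ω − z)` satisfy `(S_n − E_{φ^b} S_n)/√|Λ_n| → N(0, σ²_f)` in
distribution, `σ²_f = Σ_{z∈ℤ^d} Cov_{φ^b}(f, f ∘ T_z)` (`≥ 0`), for any `Y ~ gaussianReal 0 v`, `v = σ²_f`.
[cite: Newman1980, Thm. 2 and the remark after (12); Grimmett2006, Thm. (4.17)(b), (4.19)(b); Alexander1998, (1.1)] -/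
theorem tendstoInDistribution_localObservable {Ω' : Type*} {mΩ' : MeasurableSpace Ω'} {P' : Measure Ω'}
    [IsProbabilityMeasure P'] {Y : Ω' → ℝ} {ι : Type*} (hd : 2 ≤ d) (hq : 1 ≤ q) (hp0 : 0 ≤ p)
    (hpc : p < rcCriticalProb d q) (b : Bool) {k : ℕ} {F : Finset (Sym2 (Site d))}
    (hF : F ⊆ edgesIn (zdGraph d) (box d k)) (A : Finset ι) (c : ι → ℝ) {E : ι → Set (BondConfig (Site d))}
    (hE : ∀ a ∈ A, DeterminedBy (E a) ↑F) {v : NNReal}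
    (hv : (v : ℝ) = ∑' z : Site d, cov[fun ω => ∑ a ∈ A, c a * (E a).indicator (1 : BondConfig (Site d) → ℝ) ω,
      fun ω => ∑ a ∈ A, c a * (E a).indicator (1 : BondConfig (Site d) → ℝ)
        (BondConfig.relabel (sym2Equiv (Site.shift (-z))) ω); rcLimit d b p q])
    (hY : HasLaw Y (gaussianReal 0 v) P') :
    haveI := isProbabilityMeasure_rcLimit (d := d) b p q
    TendstoInDistribution (fun (n : ℕ) (ω : BondConfig (Site d)) => (Real.sqrt #(box d n))⁻¹ *
        (∑ z ∈ box d n, ∑ a ∈ A, c a * (E a).indicator (1 : BondConfig (Site d) → ℝ)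
            (BondConfig.relabel (sym2Equiv (Site.shift (-z))) ω) -
          ∫ ω', ∑ z ∈ box d n, ∑ a ∈ A, c a * (E a).indicator (1 : BondConfig (Site d) → ℝ)
            (BondConfig.relabel (sym2Equiv (Site.shift (-z))) ω') ∂(rcLimit d b p q)))
      atTop Y (fun _ => rcLimit d b p q) P' := by
  have hp : p ∈ Set.Icc (0 : ℝ) 1 := ⟨hp0, (hpc.trans (rcCriticalProb_lt_one hd hq)).le⟩
  haveI := isProbabilityMeasure_rcLimit (d := d) b p q
  have hμ : IsPositivelyAssociated (rcLimit d b p q) := isPositivelyAssociated_rcLimit b hp hq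
  have hEm : ∀ a ∈ A, MeasurableSet (E a) := fun a ha => measurableSet_of_isLocalEvent_holds ⟨F, hE a ha⟩
  -- the observable `f`, measurable and bounded by `C = Σ|c_a|`
  have hfm : Measurable fun ω : BondConfig (Site d) => ∑ a ∈ A, c a * (E a).indicator (1 : BondConfig (Site d) → ℝ) ω :=
    Finset.measurable_sum _ fun a ha => (measurable_const.indicator (hEm a ha)).const_mul _
  have hfb : ∀ ω : BondConfig (Site d), |∑ a ∈ A, c a * (E a).indicator (1 : BondConfig (Site d) → ℝ) ω| ≤ ∑ a ∈ A, |c a| :=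
    fun ω => (Finset.abs_sum_le_sum_abs _ _).trans (Finset.sum_le_sum fun a _ => by
      rw [abs_mul]; exact (mul_le_mul_of_nonneg_left (abs_indicator_one_le_one _ _) (abs_nonneg _)).trans_eq (mul_one _))
  -- the dominator `C · N_F`, measurable and bounded by `C · #F`
  have hedge : ∀ e : Sym2 (Site d), Measurable fun ω : BondConfig (Site d) =>
      ({ω' : BondConfig (Site d) | e ∈ ω'}).indicator (1 : BondConfig (Site d) → ℝ) ω := fun e =>
    measurable_const.indicator (measurableSet_of_isLocalEvent_holds (isLocalEvent_setOf_mem _))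
  have hNm : Measurable fun ω : BondConfig (Site d) => (∑ a ∈ A, |c a|) *
      ∑ e ∈ F, ({ω' : BondConfig (Site d) | e ∈ ω'}).indicator (1 : BondConfig (Site d) → ℝ) ω :=
    (Finset.measurable_sum _ fun e _ => hedge e).const_mul _
  have hNb : ∀ ω : BondConfig (Site d), |(∑ a ∈ A, |c a|) *
      ∑ e ∈ F, ({ω' : BondConfig (Site d) | e ∈ ω'}).indicator (1 : BondConfig (Site d) → ℝ) ω| ≤ (∑ a ∈ A, |c a|) * #F := by
    intro ω
    rw [abs_mul, abs_of_nonneg (Finset.sum_nonneg fun a _ => abs_nonneg _)]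
    refine mul_le_mul_of_nonneg_left ?_ (Finset.sum_nonneg fun a _ => abs_nonneg _)
    refine (Finset.abs_sum_le_sum_abs _ _).trans ?_
    calc ∑ e ∈ F, |({ω' : BondConfig (Site d) | e ∈ ω'}).indicator (1 : BondConfig (Site d) → ℝ) ω|
        ≤ ∑ _e ∈ F, (1 : ℝ) := Finset.sum_le_sum fun e _ => abs_indicator_one_le_one _ _
      _ = #F := by simp
  -- the translation operators are measurable
  have hT : ∀ z : Site d, Measurable (BondConfig.relabel (sym2Equiv (Site.shift (-z))) :
      BondConfig (Site d) → BondConfig (Site d)) := fun z => (BondConfig.relabel _).measurable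
  -- covariance decay constants
  obtain ⟨cst, hcst, hpair⟩ := exists_abs_cov_indicator_shift_le hd hq hp0 hpc hF
  have hsumexp := (summable_exp_neg_mul_siteRad (d := d) hcst).mul_left
    ((∑ a ∈ A, |c a|) * (∑ a ∈ A, |c a|) * (4 * (#F + 1) * Real.exp (cst * (2 * k + 1))))
  have hsumexp' := (summable_exp_neg_mul_siteRad (d := d) hcst).mul_left
    ((∑ e ∈ F, |(∑ a ∈ A, |c a|)|) * (∑ e ∈ F, |(∑ a ∈ A, |c a|)|) * (4 * (#F + 1) * Real.exp (cst * (2 * k + 1))))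
  have hdetEdge : ∀ e ∈ F, DeterminedBy {ω : BondConfig (Site d) | e ∈ ω} ↑F := fun e he => by
    rw [determinedBy_iff]; intro ω₁ ω₂ hω
    have := Set.ext_iff.1 hω e
    simp only [Set.mem_inter_iff, Finset.mem_coe, he, and_true] at this
    exact this
  refine tendstoInDistribution_boxSum_of_dominated (μ := rcLimit d b p q)
    (X := fun z ω => ∑ a ∈ A, c a * (E a).indicator (1 : BondConfig (Site d) → ℝ)
      (BondConfig.relabel (sym2Equiv (Site.shift (-z))) ω))
    (Xd := fun z ω => (∑ a ∈ A, |c a|) * ∑ e ∈ F, ({ω' : BondConfig (Site d) | e ∈ ω'}).indicator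
      (1 : BondConfig (Site d) → ℝ) (BondConfig.relabel (sym2Equiv (Site.shift (-z))) ω))
    (γ := fun z => cov[fun ω => ∑ a ∈ A, c a * (E a).indicator (1 : BondConfig (Site d) → ℝ) ω,
      fun ω => ∑ a ∈ A, c a * (E a).indicator (1 : BondConfig (Site d) → ℝ)
        (BondConfig.relabel (sym2Equiv (Site.shift (-z))) ω); rcLimit d b p q])
    (γd := fun z => cov[fun ω => (∑ a ∈ A, |c a|) * ∑ e ∈ F, ({ω' : BondConfig (Site d) | e ∈ ω'}).indicator
        (1 : BondConfig (Site d) → ℝ) ω,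
      fun ω => (∑ a ∈ A, |c a|) * ∑ e ∈ F, ({ω' : BondConfig (Site d) | e ∈ ω'}).indicator
        (1 : BondConfig (Site d) → ℝ) (BondConfig.relabel (sym2Equiv (Site.shift (-z))) ω); rcLimit d b p q])
    (le_trans one_le_two hd) hμ (fun z => hfm.comp (hT z)) (Finset.sum_nonneg fun a _ => abs_nonneg _)
    (fun z ω => hfb _) (fun x y => covariance_comp_shift_eq b hp hq hfm hfm x y) ?_ (fun z => hNm.comp (hT z))
    (fun z ω => hNb _) (fun x y => covariance_comp_shift_eq b hp hq hNm hNm x y) ?_ ?_ hv hY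
  · -- (D) for `f`
    refine Summable.of_norm_bounded hsumexp fun z => ?_
    rw [Real.norm_eq_abs]
    refine (abs_cov_combination_shift_le (rcLimit d b p q) A A c c hEm hEm z
      (fun a ha a' ha' => hpair b (hE a ha) (hE a' ha') z)).trans (le_of_eq ?_)
    ring
  · -- (D) for the dominator
    refine Summable.of_norm_bounded hsumexp' fun z => ?_
    rw [Real.norm_eq_abs]
    have h := abs_cov_combination_shift_le (rcLimit d b p q) F F (fun _ => ∑ a ∈ A, |c a|) (fun _ => ∑ a ∈ A, |c a|)
      (E := fun e => {ω : BondConfig (Site d) | e ∈ ω}) (E' := fun e => {ω : BondConfig (Site d) | e ∈ ω})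
      (fun e _ => measurableSet_of_isLocalEvent_holds (isLocalEvent_setOf_mem _))
      (fun e _ => measurableSet_of_isLocalEvent_holds (isLocalEvent_setOf_mem _)) z
      (fun e he e' he' => hpair b (hdetEdge e he) (hdetEdge e' he') z)
    simp only [← Finset.mul_sum] at h
    refine h.trans (le_of_eq ?_)
    ring
  · -- domination
    intro z ω ω' hle
    have hle' := BondConfig.relabel_mono (sym2Equiv (Site.shift (-z))) hle
    rw [← Finset.sum_sub_distrib, ← mul_sub]
    refine (Finset.abs_sum_le_sum_abs _ _).trans ?_
    rw [Finset.sum_mul]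
    refine Finset.sum_le_sum fun a ha => ?_
    rw [← mul_sub, abs_mul]
    exact mul_le_mul_of_nonneg_left (abs_indicator_sub_le_openCount_sub (hE a ha) hle') (abs_nonneg _)

end NewmanCLT

end Summit.CriticalPhenomena.PercolationContinuityZ3.Theorems.FK
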